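import Summits.ResolutionOfSingularities.ResolutionOfSingularities.Theorems.ValuativeLuAlphaPTorsorCurveMonomializationDivisors
import Summits.ResolutionOfSingularities.ResolutionOfSingularities.Theorems.ValuativeLuAlphaPTorsorCurveMonomializationResidue

/-!
# The quadratic transform reduces modulo a followed branch (Herrmann–Ikeda–Orbanz (30.2) (b))

Helper file for the stub `stub_curveMonomialization` of the line `pfaff-line-log-final-forms`
(crux `Valuative.LuAlphaPTorsor`, item `stmt-ResolutionOfSingularities-0641`).

Let `O ⊆ W` be valuation rings of `K`, `π : W → κ(W)` the residue map and `O'' = π(O)` the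
induced valuation ring of `κ(W)` (`…CurveMonomializationResidue.lean`). PROVED here
(`isQuadraticTransformAlong_residue`): **for a local subring `R ⊆ O` not dominated by `W`, the
image `π(R₁)` of the quadratic transform `R₁` of `R` along `O` is the quadratic transform of
`π(R)` along `O''`** — Herrmann–Ikeda–Orbanz, *Equimultiplicity and Blowing up*, proof of
Thm. (30.2), b): "`R^{(j)}/𝔭^{(j)}` is a quadratic transform of
`R̄^{(j-1)} = R^{(j-1)}/𝔭^{(j-1)}`" (there for the strict transform `𝔭^{(j)}` of a prime `𝔭`
with `dim R/𝔭 = 1`; here `𝔭^{(j)} = 𝔪_W ∩ R^{(j)}` for the valuation ring `W = R_𝔭 ⊇ O`).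
[cite: HerrmannIkedaOrbanz1988, Thm. (30.2) (proof)]
-/

set_option linter.dupNamespace false

namespace Summit.ResolutionOfSingularities.ResolutionOfSingularities.Theorems.PfaffLine.CurveMono

open IsLocalRing Literature.AlgebraicGeometry.Resolution

variable {K : Type} [Field K]

/-! ## The quadratic transform reduces to the quadratic transform of the image -/

/-- **Herrmann–Ikeda–Orbanz (30.2) (b): the quadratic transform along `O` reduces, modulo a
branch followed by `O`, to the quadratic transform of the reduced ring.** Let `O ⊆ W` be
valuation rings of `K`, `O''` the image of `O` in `κ(W)`, `R ⊆ O` a local subring NOT dominated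
by `W`, and `R₁` the quadratic transform of `R` along `O`. Then `π(R₁)` is the quadratic
transform of `π(R)` along `O''`: if `R₁ = (R[𝔪_R/x])_{𝔪_O ∩ R[𝔪_R/x]}` with `x` a generator of
minimal value, then `w(x) = 0` (else `W` would dominate `R`), `π(𝔪_R) = 𝔪_{π(R)}` is generated
by the images of the generators, `π(x) ≠ 0` has minimal `O''`-value among them, and `π`
commutes with adjoining the `y/x` and with localising at the centre.
[cite: HerrmannIkedaOrbanz1988, Thm. (30.2) (proof)] -/
theorem isQuadraticTransformAlong_residue {O W : ValuationSubring K} (hOW : O ≤ W)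
    {O'' : ValuationSubring (ResidueField W)}
    (hO'' : O''.toSubring = (O.toSubring.comap W.subtype).map (residue W))
    {R R₁ : Subring K} (h : IsQuadraticTransformAlong O R R₁)
    (hnd : ¬ SubringDominates R W.toSubring) :
    IsQuadraticTransformAlong O'' ((R.comap W.subtype).map (residue W))
      ((R₁.comap W.subtype).map (residue W)) := by
  classical
  obtain ⟨hloc, hRO, u, u₀, hu, hu₀, h0, hval, hR₁⟩ := h
  have hRW : R ≤ W.toSubring := fun x hx => hOW (hRO hx)
  set D : Subring (ResidueField W) := (R.comap W.subtype).map (residue W) with hD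
  -- the surjection `θ : R → D`
  have hθD : ∀ x : R, (residue W).comp (Subring.inclusion hRW) x ∈ D := fun x => ⟨_, x.2, rfl⟩
  let θ : R →+* D := ((residue W).comp (Subring.inclusion hRW)).codRestrict D hθD
  have hθapply : ∀ x : R, (θ x : ResidueField W) = residue W ⟨(x : K), hRW x.2⟩ := fun x => rfl
  have hθ : Function.Surjective θ := by
    rintro ⟨_, w, hw, rfl⟩
    exact ⟨⟨(w : K), hw⟩, Subtype.ext rfl⟩
  haveI hDloc : IsLocalRing D := IsLocalRing.of_surjective' θ hθ
  have hθ0 : ∀ x : R, θ x = 0 ↔ W.valuation (x : K) < 1 := fun x => by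
    rw [Subtype.ext_iff, hθapply]
    change residue W ⟨(x : K), hRW x.2⟩ = 0 ↔ _
    rw [IsLocalRing.residue_eq_zero_iff, ValuationSubring.valuation_lt_one_iff]
  -- `θ⁻¹(𝔪_D) = 𝔪_R`
  have hmD : ∀ x : R, θ x ∈ maximalIdeal D ↔ x ∈ maximalIdeal R := by
    intro x
    constructor
    · intro hx
      by_contra hxu
      exact (IsLocalRing.mem_maximalIdeal _).mp hx ((IsLocalRing.notMem_maximalIdeal.mp hxu).map θ)
    · intro hx
      by_contra hunit
      obtain ⟨d, hd⟩ := (IsLocalRing.notMem_maximalIdeal.mp hunit).exists_right_inv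
      obtain ⟨y, rfl⟩ := hθ d
      have h1 : θ (x * y - 1) = 0 := by rw [map_sub, map_mul, hd, map_one, sub_self]
      rw [hθ0, valuation_lt_one_iff_or] at h1
      have hm1 : x * y - 1 ∈ maximalIdeal R := by
        rw [mem_maximalIdeal_iff_inv_not_mem]
        exact h1.imp_right fun h' hR => h' (hRW hR)
      have hxy : IsUnit (x * y) := by
        have := IsLocalRing.isUnit_one_sub_self_of_mem_nonunits (1 - x * y)
          (by rw [← neg_sub]; exact (maximalIdeal R).neg_mem hm1)
        rwa [sub_sub_cancel] at this
      exact hx (isUnit_of_mul_isUnit_left hxy)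
  have hmapm : (maximalIdeal R).map θ = maximalIdeal D := by
    apply le_antisymm
    · rw [Ideal.map_le_iff_le_comap]
      exact fun x hx => (hmD x).mpr hx
    · intro d hd
      obtain ⟨x, rfl⟩ := hθ d
      exact Ideal.mem_map_of_mem θ ((hmD x).mp hd)
  -- `w(u₀) = 0`: otherwise every generator, hence all of `𝔪_R`, has positive `W`-value
  have h0K : ((u₀ : R) : K) ≠ 0 := fun e => h0 (Subtype.ext e)
  have hdivO : ∀ x ∈ u, ((x : R) : K) / u₀ ∈ O := fun x hx => by
    rw [← O.valuation_le_one_iff, map_div₀, div_le_one₀ (pos_iff_ne_zero.mpr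
      ((map_ne_zero _).mpr h0K))]
    exact hval x hx
  have hu₀W : W.valuation (u₀ : K) = 1 := by
    by_contra hne
    have hlt : W.valuation (u₀ : K) < 1 :=
      lt_of_le_of_ne ((W.valuation_le_one_iff _).mpr (hRW u₀.2)) hne
    refine hnd (dominates_of_maximalIdeal hRW fun y hy => ?_)
    have key : maximalIdeal R ≤ (maximalIdeal W).comap (Subring.inclusion hRW) := by
      rw [← hu, Ideal.span_le]
      intro x hx
      rw [SetLike.mem_coe, Ideal.mem_comap, ValuationSubring.valuation_lt_one_iff]
      change W.valuation ((x : R) : K) < 1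
      have e : ((x : R) : K) = (x : K) / u₀ * u₀ := by rw [div_mul_cancel₀ _ h0K]
      rw [e, map_mul]
      calc W.valuation ((x : K) / u₀) * W.valuation (u₀ : K) ≤ 1 * W.valuation (u₀ : K) :=
            mul_le_mul' ((W.valuation_le_one_iff _).mpr (hOW (hdivO x hx))) le_rfl
        _ < 1 := by rw [one_mul]; exact hlt
    have := key hy
    rw [Ideal.mem_comap, ValuationSubring.valuation_lt_one_iff] at this
    exact this
  have hθu₀ : (θ u₀ : ResidueField W) ≠ 0 := by
    rw [hθapply]; exact (residue_ne_zero_iff _).mpr hu₀W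
  have hθu₀' : θ u₀ ≠ 0 := fun e => hθu₀ (by rw [e]; rfl)
  -- the ring generated by `R` and the `x/u₀`, inside `O`
  set C : Subring K := Subring.closure ((R : Set K) ∪ (fun x : R => (x : K) / u₀) '' ↑u) with hC
  have hCO : C ≤ O.toSubring := by
    refine Subring.closure_le.mpr ?_
    rintro z (hz | ⟨x, hx, rfl⟩)
    · exact hRO hz
    · exact hdivO x hx
  have hsW : ((R : Set K) ∪ (fun x : R => (x : K) / u₀) '' ↑u) ⊆ W := by
    rintro z (hz | ⟨x, hx, rfl⟩)
    · exact hRW hz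
    · exact hOW (hdivO x hx)
  -- the images of the generators
  have hA : residue W '' (W.subtype ⁻¹' (R : Set K)) = (D : Set (ResidueField W)) := by
    rw [hD, Subring.coe_map, Subring.coe_comap]
  have hB : residue W '' (W.subtype ⁻¹' ((fun x : R => (x : K) / u₀) '' ↑u)) =
      (fun x : D => (x : ResidueField W) / (θ u₀ : D)) '' ↑(u.image θ) := by
    ext ℓ
    constructor
    · rintro ⟨w, hw, rfl⟩
      obtain ⟨x, hx, hwe⟩ := hw
      obtain ⟨hmem, hdiv, -⟩ := residue_div (hRW x.2) (hRW u₀.2) hu₀W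
      refine ⟨θ x, ?_, ?_⟩
      · rw [Finset.coe_image]; exact ⟨x, hx, rfl⟩
      · have hw' : w = ⟨(x : K) / u₀, hmem⟩ := Subtype.ext hwe.symm
        change (θ x : ResidueField W) / (θ u₀ : ResidueField W) = residue W w
        rw [hw', hdiv]
        rfl
    · rintro ⟨y, hy, rfl⟩
      rw [Finset.coe_image] at hy
      obtain ⟨x, hx, rfl⟩ := hy
      obtain ⟨hmem, hdiv, -⟩ := residue_div (hRW x.2) (hRW u₀.2) hu₀W
      refine ⟨⟨(x : K) / u₀, hmem⟩, ⟨x, hx, rfl⟩, ?_⟩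
      change residue W ⟨(x : K) / u₀, hmem⟩ = (θ x : ResidueField W) / (θ u₀ : ResidueField W)
      rw [hdiv]
      rfl
  have himg : residue W '' (W.subtype ⁻¹' ((R : Set K) ∪ (fun x : R => (x : K) / u₀) '' ↑u)) =
      (D : Set (ResidueField W)) ∪
        (fun x : D => (x : ResidueField W) / (θ u₀ : D)) '' ↑(u.image θ) := by
    rw [Set.preimage_union, Set.image_union, hA, hB]
  refine ⟨hDloc, residue_le hO'' R hRO, u.image θ, θ u₀, ?_, Finset.mem_image_of_mem θ hu₀,
    hθu₀', ?_, ?_⟩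
  · rw [Finset.coe_image, ← Ideal.map_span, hu, hmapm]
  · intro y hy
    obtain ⟨x, hx, rfl⟩ := Finset.mem_image.mp hy
    obtain ⟨hmem, hdiv, -⟩ := residue_div (hRW x.2) (hRW u₀.2) hu₀W
    have hq : O''.valuation ((θ x : ResidueField W) / (θ u₀ : ResidueField W)) ≤ 1 := by
      rw [O''.valuation_le_one_iff, hθapply, hθapply, ← hdiv]
      exact residue_mem hO'' (hdivO x hx)
    rwa [map_div₀, div_le_one₀ (pos_iff_ne_zero.mpr ((map_ne_zero _).mpr hθu₀))] at hq
  · rw [hR₁, residue_locAtCentre hOW hO'' hCO, hC, residue_closure hsW, himg]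

end Summit.ResolutionOfSingularities.ResolutionOfSingularities.Theorems.PfaffLine.CurveMono

namespace Summit.ResolutionOfSingularities.ResolutionOfSingularities.Theorems.PfaffLine

/-- **Registered sub-goal `curveMono_isQuadraticTransformAlong_residue`** (universe `0`, for
`--supports` registration): Herrmann–Ikeda–Orbanz (30.2) (b), the quadratic transform along `O`
reduces modulo a branch followed by `O` to the quadratic transform of the reduced ring.
[cite: HerrmannIkedaOrbanz1988, Thm. (30.2) (proof)] -/
theorem curveMono_isQuadraticTransformAlong_residue : ∀ {K : Type} [Field K] {O W : ValuationSubring K}, O ≤ W → ∀ {O'' : ValuationSubring (IsLocalRing.ResidueField W)}, O''.toSubring = (O.toSubring.comap W.subtype).map (IsLocalRing.residue W) → ∀ {R R₁ : Subring K}, Literature.AlgebraicGeometry.Resolution.IsQuadraticTransformAlong O R R₁ → ¬ Literature.AlgebraicGeometry.Resolution.SubringDominates R W.toSubring → Literature.AlgebraicGeometry.Resolution.IsQuadraticTransformAlong O'' ((R.comap W.subtype).map (IsLocalRing.residue W)) ((R₁.comap W.subtype).map (IsLocalRing.residue W)) := by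
  intro K _ O W hOW O'' hO'' R R₁ h hnd
  exact CurveMono.isQuadraticTransformAlong_residue hOW hO'' h hnd

end Summit.ResolutionOfSingularities.ResolutionOfSingularities.Theorems.PfaffLine
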